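import Literature.Analysis.FluidPDE.JiaSverak2014HolderRepresentative
import HarnessLib

/-!
# Jia–Šverák 2014, local higher regularity: the base level of the bootstrap

Analysis/FluidPDE proofs file (theorems only; no definitions, no named facts), part of the proof
of the named fact `Literature.Analysis.FluidPDE.jia_sverak_2014_local_higher_regularity`
(`JiaSverak2014LocalRegularity.lean`; H. Jia, V. Šverák, Invent. Math. 196 (2014) =
arXiv:1204.0529, §3 Thm 3.2 and the bootstrap remark after its proof, p. 9; §4 proof of
Thm 4.1). The bootstrap to all orders runs over *levels*: a level-`n` representative of the
solution `u` near `(0, x₀)` is a global field `R : ℝ → ℝ³ → ℝ³`, jointly measurable, with `C^{n,γ}`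
slices bounded uniformly, agreeing with `u(t)` a.e. on a ball for a.e. small `t`. This file
provides level `0` from the parabolic Hölder continuous representative of the tree
(`holder_representative`, the printed Thm 3.2): the representative is frozen in time outside
`[0, T_b]` and cut off in space inside `B(x₀, 1/4)`.

* `exists_baseCutoff` — a Lipschitz cut-off `= 1` on `B̄(0,3/16)`, supported in `B̄(0,7/32)`;
* `base_level` — the level-`0` representative on `B(x₀, 3/16)`.

## References

* H. Jia, V. Šverák, Invent. Math. 196 (2014) = arXiv:1204.0529, §3 Thm 3.2 and p. 9; §4.
  Bib key `JiaSverak2014`.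
-/

noncomputable section

open MeasureTheory TopologicalSpace Set Function Filter Metric
open _root_.Topology
open scoped ENNReal NNReal RealInnerProductSpace

namespace Literature.Analysis.FluidPDE

namespace JiaSverak2014

open Literature.Analysis.UnboundedOperators LemarieRieusset2016

/-- A cut-off at the origin, `= 1` on `B̄(0, 3/16)`, vanishing off `B̄(0, 7/32)`, with values in
`[0,1]` and `D`-Lipschitz. [folklore] -/
theorem exists_baseCutoff :
    ∃ (η₀ : (EuclideanSpace ℝ (Fin 3)) → ℝ) (D : ℝ), 0 ≤ D ∧ Continuous η₀ ∧
      (∀ x, 0 ≤ η₀ x) ∧ (∀ x, η₀ x ≤ 1) ∧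
      (∀ x ∈ closedBall (0 : EuclideanSpace ℝ (Fin 3)) (3 / 16), η₀ x = 1) ∧
      (∀ x, x ∉ closedBall (0 : EuclideanSpace ℝ (Fin 3)) (7 / 32) → η₀ x = 0) ∧
      (∀ x y, |η₀ x - η₀ y| ≤ D * ‖x - y‖) := by
  let θ : ContDiffBump (0 : EuclideanSpace ℝ (Fin 3)) := ⟨3 / 16, 7 / 32, by norm_num, by norm_num⟩
  have hrIn : θ.rIn = 3 / 16 := rfl
  have hrOut : θ.rOut = 7 / 32 := rfl
  have hχ : ContDiff ℝ (⊤ : ℕ∞) θ := θ.contDiff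
  have hχc : HasCompactSupport (θ : (EuclideanSpace ℝ (Fin 3)) → ℝ) := θ.hasCompactSupport
  have hDcont : Continuous fun x => fderiv ℝ (θ : (EuclideanSpace ℝ (Fin 3)) → ℝ) x := hχ.continuous_fderiv (by simp)
  have hDK : ∀ x ∉ tsupport (θ : (EuclideanSpace ℝ (Fin 3)) → ℝ), fderiv ℝ (θ : (EuclideanSpace ℝ (Fin 3)) → ℝ) x = 0 := fun x hx => by
    have h0 : (θ : (EuclideanSpace ℝ (Fin 3)) → ℝ) =ᶠ[𝓝 x] fun _ => (0 : ℝ) := notMem_tsupport_iff_eventuallyEq.1 hx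
    rw [h0.fderiv_eq, fderiv_fun_const]; rfl
  obtain ⟨D, hD⟩ := hDcont.bounded_above_of_compact_support (HasCompactSupport.intro hχc fun x hx => hDK x hx)
  have hD0 : 0 ≤ D := (norm_nonneg _).trans (hD 0)
  refine ⟨θ, D, hD0, hχ.continuous, fun x => θ.nonneg, fun x => θ.le_one, ?_, ?_, ?_⟩
  · intro x hx
    exact θ.one_of_mem_closedBall (by rwa [hrIn])
  · intro x hx
    refine image_eq_zero_of_notMem_tsupport fun h => hx ?_
    rwa [θ.tsupport_eq, hrOut] at h
  · intro x y
    rw [← Real.norm_eq_abs]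
    have h := Convex.norm_image_sub_le_of_norm_fderiv_le (f := (θ : (EuclideanSpace ℝ (Fin 3)) → ℝ))
      (fun z _ => (hχ.differentiable (by simp)).differentiableAt) (fun z _ => hD z) convex_univ (mem_univ y) (mem_univ x)
    simpa [mul_comm] using h

set_option maxHeartbeats 1600000 in
/-- **The base level of the bootstrap.** For `0 < γ < 1`, `K_b ≥ 0`, `α_u` and `M` there is `𝒞₀`
such that for every local Leray solution as in `holder_representative` (datum bounded by `M` and
`(M,γ)`-Hölderian on `B(x₀,2)`, `|u| ≤ K_b` a.e. on `(0,T_b') × B(x₀,7/12)`, uniformly local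
energy `≤ α_u`, `0 < T_b < T_b' ≤ T'`, `T_b' ≤ 1`) there is a *global* level-`0` representative
`R : ℝ → ℝ³ → ℝ³`: jointly continuous, `|R| ≤ 𝒞₀`, `|R(t,x) - R(t,y)| ≤ 𝒞₀|x - y|^γ` for all
`t, x, y`, and `R(t) = u(t)` a.e. on `B(x₀, 3/16)` for a.e. `t ∈ (0,T_b)` (the Hölder continuous
representative of the tree, `holder_representative`, frozen in time outside `[0,T_b]` and cut off
inside `B(x₀,1/4)`). [cite: JiaSverak2014, §3 proof of Thm. 3.2 (arXiv p. 9)] -/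
theorem base_level (M γ : ℝ≥0) (hγ0 : 0 < (γ : ℝ)) (hγ1 : (γ : ℝ) < 1) {Kb : ℝ} (hKb : 0 ≤ Kb) (αu : ℝ≥0) :
    ∃ 𝒞₀ : ℝ, 0 ≤ 𝒞₀ ∧ ∀ {T' : ℝ} {x₀ : EuclideanSpace ℝ (Fin 3)}
      {u₀ : (EuclideanSpace ℝ (Fin 3)) → (EuclideanSpace ℝ (Fin 3))}
      {u : ℝ → (EuclideanSpace ℝ (Fin 3)) → (EuclideanSpace ℝ (Fin 3))} {p : ℝ → (EuclideanSpace ℝ (Fin 3)) → ℝ}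
      {Tb Tb' : ℝ},
      AEStronglyMeasurable u₀ volume → IsLocalLeraySolutionOn T' 1 u₀ u p →
      0 < Tb → Tb < Tb' → Tb' ≤ T' → Tb' ≤ 1 →
      (∀ x ∈ ball x₀ 2, ‖u₀ x‖ ≤ M) → HolderOnWith M γ u₀ (ball x₀ 2) →
      (∀ᵐ z ∂(volume.restrict (Ioo 0 Tb' ×ˢ ball x₀ (7 / 12))), ‖u z.1 z.2‖ ≤ Kb) →
      (∀ᵐ t ∂(volume.restrict (Ioo 0 T')), ∀ z : EuclideanSpace ℝ (Fin 3), ∫⁻ x in ball z 1, ‖u t x‖ₑ ^ 2 ≤ αu) →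
      ∃ R : ℝ → (EuclideanSpace ℝ (Fin 3)) → (EuclideanSpace ℝ (Fin 3)),
        StronglyMeasurable (uncurry R) ∧ (∀ t, ContDiff ℝ 0 (R t)) ∧
        (∀ t, ∀ k ≤ 0, ∀ x, ‖iteratedFDeriv ℝ k (R t) x‖ ≤ 𝒞₀) ∧
        (∀ t x y, ‖iteratedFDeriv ℝ 0 (R t) x - iteratedFDeriv ℝ 0 (R t) y‖ ≤ 𝒞₀ * ‖x - y‖ ^ (γ : ℝ)) ∧
        (∀ x ∈ ball x₀ (3 / 16), R 0 x = u₀ x) ∧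
        ∀ᵐ t ∂(volume.restrict (Ioo 0 Tb)), ∀ᵐ x ∂(volume.restrict (ball x₀ (3 / 16))), R t x = u t x := by
  obtain ⟨CU, hCU⟩ := holder_representative M γ hγ0 hγ1 hKb αu
  obtain ⟨η₀, D, hD0, hηc, hηnn, hηle, hηone, hηzero, hηLip⟩ := exists_baseCutoff
  obtain ⟨C', hC'0, hCUC'⟩ : ∃ C' : ℝ, 0 ≤ C' ∧ CU ≤ C' := ⟨max CU 0, le_max_right _ _, le_max_left _ _⟩
  refine ⟨D * C' + 2 * C', by positivity, ?_⟩
  intro T' x₀ u₀ u p Tb Tb' hm₀ hu hTb hTbTb' hTb'T' hTb1 hM hH hbd hαu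
  obtain ⟨U, hUae, hU0, hUb, hUH⟩ := hCU hm₀ hu hTb hTbTb' hTb'T' (hTbTb'.le.trans hTb1) hM hH hbd hαu
  -- curried bounds on the Hölder representative
  have hUb' : ∀ t ∈ Icc (0 : ℝ) Tb, ∀ x ∈ closedBall x₀ (1 / 4 : ℝ), ‖U t x‖ ≤ C' := fun t ht x hx =>
    (hUb (t, x) ⟨ht, hx⟩).trans hCUC'
  have hUH' : ∀ t ∈ Icc (0 : ℝ) Tb, ∀ x ∈ closedBall x₀ (1 / 4 : ℝ), ∀ y ∈ closedBall x₀ (1 / 4 : ℝ),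
      ‖U t x - U t y‖ ≤ C' * ‖x - y‖ ^ (γ : ℝ) := by
    intro t ht x hx y hy
    have h := hUH (t, x) ⟨ht, hx⟩ (t, y) ⟨ht, hy⟩
    simp only [uncurry, sub_self, abs_zero, Real.zero_rpow (by norm_num : (1 / 2 : ℝ) ≠ 0), zero_add] at h
    exact h.trans (mul_le_mul_of_nonneg_right hCUC' (Real.rpow_nonneg (norm_nonneg _) _))
  -- the cut-off at `x₀`
  obtain ⟨η, hηc', hη1, hη0, hηabs, hηL⟩ : ∃ η : (EuclideanSpace ℝ (Fin 3)) → ℝ, Continuous η ∧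
      (∀ x ∈ closedBall x₀ (3 / 16 : ℝ), η x = 1) ∧ (∀ x, x ∉ closedBall x₀ (7 / 32 : ℝ) → η x = 0) ∧
      (∀ x, |η x| ≤ 1) ∧ (∀ x y, |η x - η y| ≤ D * ‖x - y‖) := by
    refine ⟨fun x => η₀ (x - x₀), hηc.comp (continuous_id.sub continuous_const), ?_, ?_, ?_, ?_⟩
    · intro x hx
      refine hηone _ ?_
      rw [mem_closedBall, dist_zero_right]; rwa [mem_closedBall, dist_eq_norm] at hx
    · intro x hx
      refine hηzero _ fun h => hx ?_
      rw [mem_closedBall, dist_zero_right] at h; rwa [mem_closedBall, dist_eq_norm]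
    · intro x; rw [abs_of_nonneg (hηnn _)]; exact hηle _
    · intro x y
      have h := hηLip (x - x₀) (y - x₀); rwa [show x - x₀ - (y - x₀) = x - y by abel] at h
  -- the time clamp
  obtain ⟨cl, hclI, hclc, hcl_id⟩ : ∃ cl : ℝ → ℝ, (∀ t, cl t ∈ Icc (0 : ℝ) Tb) ∧ Continuous cl ∧
      ∀ t ∈ Icc (0 : ℝ) Tb, cl t = t := by
    refine ⟨fun t => max 0 (min t Tb), fun t => ⟨le_max_left _ _, max_le hTb.le (min_le_right _ _)⟩,
      continuous_const.max (continuous_id.min continuous_const), fun t ht => ?_⟩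
    simp only [min_eq_left ht.2, max_eq_right ht.1]
  -- the representative
  obtain ⟨R, hR⟩ : ∃ R : ℝ → (EuclideanSpace ℝ (Fin 3)) → (EuclideanSpace ℝ (Fin 3)), ∀ t x, R t x = η x • U (cl t) x :=
    ⟨fun t x => η x • U (cl t) x, fun _ _ => rfl⟩
  have hcb : closedBall x₀ (7 / 32 : ℝ) ⊆ closedBall x₀ (1 / 4 : ℝ) := closedBall_subset_closedBall (by norm_num)
  have hcb' : closedBall x₀ (7 / 32 : ℝ) ⊆ ball x₀ (1 / 4 : ℝ) := closedBall_subset_ball (by norm_num)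
  -- sup bound
  have hRb : ∀ t x, ‖R t x‖ ≤ C' := by
    intro t x
    by_cases hx : x ∈ closedBall x₀ (7 / 32 : ℝ)
    · rw [hR, norm_smul, Real.norm_eq_abs]
      calc |η x| * ‖U (cl t) x‖ ≤ 1 * C' :=
            mul_le_mul (hηabs x) (hUb' _ (hclI t) _ (hcb hx)) (norm_nonneg _) zero_le_one
        _ = C' := one_mul _
    · rw [hR, hη0 x hx, zero_smul, norm_zero]; exact hC'0
  -- Hölder bound
  have hrpow0 : ∀ x y : EuclideanSpace ℝ (Fin 3), 0 ≤ ‖x - y‖ ^ (γ : ℝ) := fun x y => Real.rpow_nonneg (norm_nonneg _) _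
  have hlin : ∀ x y : EuclideanSpace ℝ (Fin 3), ‖x - y‖ ≤ 1 → D * C' * ‖x - y‖ ≤ D * C' * ‖x - y‖ ^ (γ : ℝ) :=
    fun x y hxy => mul_le_mul_of_nonneg_left (Real.self_le_rpow_of_le_one (norm_nonneg _) hxy hγ1.le) (by positivity)
  have hmixed : ∀ t x y, x ∈ closedBall x₀ (7 / 32 : ℝ) → y ∉ closedBall x₀ (7 / 32 : ℝ) →
      ‖R t x - R t y‖ ≤ (D * C' + 2 * C') * ‖x - y‖ ^ (γ : ℝ) := by
    intro t x y hx hy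
    have hUx : ‖U (cl t) x‖ ≤ C' := hUb' _ (hclI t) _ (hcb hx)
    have e1 : ‖R t x - R t y‖ = |η x - η y| * ‖U (cl t) x‖ := by
      rw [hR, hR, hη0 y hy, zero_smul, sub_zero, norm_smul, Real.norm_eq_abs, sub_zero]
    rw [e1]
    by_cases hxy : ‖x - y‖ ≤ 1
    · calc |η x - η y| * ‖U (cl t) x‖ ≤ (D * ‖x - y‖) * C' := mul_le_mul (hηL x y) hUx (norm_nonneg _) (by positivity)
        _ = D * C' * ‖x - y‖ := by ring
        _ ≤ D * C' * ‖x - y‖ ^ (γ : ℝ) := hlin x y hxy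
        _ ≤ (D * C' + 2 * C') * ‖x - y‖ ^ (γ : ℝ) := by
            refine mul_le_mul_of_nonneg_right (by linarith) (hrpow0 x y)
    · have h1 : (1 : ℝ) ≤ ‖x - y‖ ^ (γ : ℝ) := Real.one_le_rpow (not_le.1 hxy).le hγ0.le
      have h2 : |η x - η y| ≤ 2 := (abs_sub _ _).trans (by linarith [hηabs x, hηabs y])
      calc |η x - η y| * ‖U (cl t) x‖ ≤ 2 * C' := mul_le_mul h2 hUx (norm_nonneg _) (by norm_num)
        _ ≤ 2 * C' * ‖x - y‖ ^ (γ : ℝ) := le_mul_of_one_le_right (by positivity) h1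
        _ ≤ (D * C' + 2 * C') * ‖x - y‖ ^ (γ : ℝ) := by
            refine mul_le_mul_of_nonneg_right ?_ (hrpow0 x y)
            nlinarith
  have hRH : ∀ t x y, ‖R t x - R t y‖ ≤ (D * C' + 2 * C') * ‖x - y‖ ^ (γ : ℝ) := by
    intro t x y
    by_cases hx : x ∈ closedBall x₀ (7 / 32 : ℝ)
    · by_cases hy : y ∈ closedBall x₀ (7 / 32 : ℝ)
      · -- both inside `B̄(x₀, 1/4)`
        have hxy : ‖x - y‖ ≤ 1 := by
          have hx' := hx; have hy' := hy
          rw [mem_closedBall, dist_eq_norm] at hx' hy'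
          calc ‖x - y‖ = ‖(x - x₀) - (y - x₀)‖ := by congr 1; abel
            _ ≤ ‖x - x₀‖ + ‖y - x₀‖ := norm_sub_le _ _
            _ ≤ 1 := by linarith
        have e1 : R t x - R t y = (η x - η y) • U (cl t) x + η y • (U (cl t) x - U (cl t) y) := by
          rw [hR, hR, sub_smul, smul_sub]; abel
        rw [e1]
        have hHt : ‖U (cl t) x - U (cl t) y‖ ≤ C' * ‖x - y‖ ^ (γ : ℝ) := hUH' _ (hclI t) _ (hcb hx) _ (hcb hy)
        have hUx : ‖U (cl t) x‖ ≤ C' := hUb' _ (hclI t) _ (hcb hx)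
        calc ‖(η x - η y) • U (cl t) x + η y • (U (cl t) x - U (cl t) y)‖
            ≤ |η x - η y| * ‖U (cl t) x‖ + |η y| * ‖U (cl t) x - U (cl t) y‖ := by
              refine (norm_add_le _ _).trans (add_le_add ?_ ?_) <;> rw [norm_smul, Real.norm_eq_abs]
          _ ≤ (D * ‖x - y‖) * C' + 1 * (C' * ‖x - y‖ ^ (γ : ℝ)) :=
              add_le_add (mul_le_mul (hηL x y) hUx (norm_nonneg _) (by positivity))
                (mul_le_mul (hηabs y) hHt (norm_nonneg _) zero_le_one)
          _ = D * C' * ‖x - y‖ + C' * ‖x - y‖ ^ (γ : ℝ) := by ring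
          _ ≤ D * C' * ‖x - y‖ ^ (γ : ℝ) + C' * ‖x - y‖ ^ (γ : ℝ) := add_le_add (hlin x y hxy) le_rfl
          _ ≤ (D * C' + 2 * C') * ‖x - y‖ ^ (γ : ℝ) := by
              have h0 : 0 ≤ C' * ‖x - y‖ ^ (γ : ℝ) := mul_nonneg hC'0 (hrpow0 x y)
              nlinarith
      · exact hmixed t x y hx hy
    · by_cases hy : y ∈ closedBall x₀ (7 / 32 : ℝ)
      · rw [norm_sub_rev, norm_sub_rev x y]; exact hmixed t y x hy hx
      · rw [hR, hR, hη0 x hx, hη0 y hy, zero_smul, zero_smul, sub_self, norm_zero]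
        exact mul_nonneg (by positivity) (hrpow0 x y)
  -- continuity
  have hS_sub : ∀ t (x : EuclideanSpace ℝ (Fin 3)), x ∈ ball x₀ (1 / 4 : ℝ) →
      ((cl t, x) : ℝ × EuclideanSpace ℝ (Fin 3)) ∈ Icc (0 : ℝ) Tb ×ˢ closedBall x₀ (1 / 4 : ℝ) :=
    fun t x hx => ⟨hclI t, ball_subset_closedBall hx⟩
  have hUc : ContinuousOn (uncurry U) (Icc (0 : ℝ) Tb ×ˢ closedBall x₀ (1 / 4 : ℝ)) := by
    intro z hz
    rw [ContinuousWithinAt, tendsto_iff_norm_sub_tendsto_zero]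
    have hb : ∀ z' ∈ Icc (0 : ℝ) Tb ×ˢ closedBall x₀ (1 / 4 : ℝ),
        ‖uncurry U z' - uncurry U z‖ ≤ CU * (|z'.1 - z.1| ^ (1 / 2 : ℝ) + ‖z'.2 - z.2‖) ^ (γ : ℝ) :=
      fun z' hz' => hUH z' hz' z hz
    have hlim : Tendsto (fun z' : ℝ × EuclideanSpace ℝ (Fin 3) => CU * (|z'.1 - z.1| ^ (1 / 2 : ℝ) + ‖z'.2 - z.2‖) ^ (γ : ℝ))
        (𝓝[Icc (0 : ℝ) Tb ×ˢ closedBall x₀ (1 / 4 : ℝ)] z) (𝓝 0) := by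
      have hc1 : Continuous fun z' : ℝ × EuclideanSpace ℝ (Fin 3) => |z'.1 - z.1| ^ (1 / 2 : ℝ) + ‖z'.2 - z.2‖ :=
        ((continuous_abs.comp (continuous_fst.sub continuous_const)).rpow_const fun _ => Or.inr (by norm_num)).add
          (continuous_snd.sub continuous_const).norm
      have h1 : Tendsto (fun z' : ℝ × EuclideanSpace ℝ (Fin 3) => |z'.1 - z.1| ^ (1 / 2 : ℝ) + ‖z'.2 - z.2‖) (𝓝 z) (𝓝 0) := by
        have h := hc1.tendsto z
        simp only [sub_self, abs_zero, Real.zero_rpow (by norm_num : (1 / 2 : ℝ) ≠ 0), norm_zero, add_zero] at h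
        exact h
      have h2 : Tendsto (fun z' : ℝ × EuclideanSpace ℝ (Fin 3) => (|z'.1 - z.1| ^ (1 / 2 : ℝ) + ‖z'.2 - z.2‖) ^ (γ : ℝ)) (𝓝 z) (𝓝 0) := by
        have := h1.rpow_const (p := (γ : ℝ)) (Or.inr hγ0.le)
        rwa [Real.zero_rpow hγ0.ne'] at this
      have h3 := h2.const_mul CU
      rw [mul_zero] at h3
      exact h3.mono_left nhdsWithin_le_nhds
    exact squeeze_zero_norm' (eventually_nhdsWithin_of_forall fun z' hz' => by
      rw [norm_norm]; exact hb z' hz') hlim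
  have hRfun : uncurry R = fun z : ℝ × EuclideanSpace ℝ (Fin 3) => η z.2 • uncurry U (cl z.1, z.2) := by
    funext z; simp only [uncurry, hR]
  have hRc : Continuous (uncurry R) := by
    rw [continuous_iff_continuousAt]
    rintro ⟨t, x⟩
    by_cases hx : x ∈ closedBall x₀ (7 / 32 : ℝ)
    · -- near `x` we stay inside `B(x₀, 1/4)`
      have hxB : x ∈ ball x₀ (1 / 4 : ℝ) := hcb' hx
      have hopen : IsOpen ((univ : Set ℝ) ×ˢ ball x₀ (1 / 4 : ℝ)) := isOpen_univ.prod isOpen_ball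
      have hg : ContinuousAt (fun z : ℝ × EuclideanSpace ℝ (Fin 3) => uncurry U (cl z.1, z.2)) (t, x) := by
        have hmap : Continuous (fun z : ℝ × EuclideanSpace ℝ (Fin 3) => ((cl z.1, z.2) : ℝ × EuclideanSpace ℝ (Fin 3))) :=
          (hclc.comp continuous_fst).prodMk continuous_snd
        have hcomp : ContinuousWithinAt (fun z : ℝ × EuclideanSpace ℝ (Fin 3) => uncurry U (cl z.1, z.2))
            ((univ : Set ℝ) ×ˢ ball x₀ (1 / 4 : ℝ)) (t, x) :=
          ContinuousWithinAt.comp (f := fun z : ℝ × EuclideanSpace ℝ (Fin 3) => ((cl z.1, z.2) : ℝ × EuclideanSpace ℝ (Fin 3)))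
            (g := uncurry U) (hUc _ (hS_sub t x hxB)) hmap.continuousWithinAt
            (fun z hz => hS_sub z.1 z.2 hz.2)
        exact hcomp.continuousAt (hopen.mem_nhds ⟨mem_univ _, hxB⟩)
      rw [hRfun]
      exact ((hηc'.comp continuous_snd).continuousAt).smul hg
    · have h0 : uncurry R =ᶠ[𝓝 (t, x)] fun _ => 0 := by
        have hopen : IsOpen ((univ : Set ℝ) ×ˢ (closedBall x₀ (7 / 32 : ℝ))ᶜ) :=
          isOpen_univ.prod isClosed_closedBall.isOpen_compl
        filter_upwards [hopen.mem_nhds (show (t, x) ∈ (univ : Set ℝ) ×ˢ (closedBall x₀ (7 / 32 : ℝ))ᶜ from ⟨mem_univ _, hx⟩)]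
          with z hz
        simp only [uncurry, hR, hη0 z.2 hz.2, zero_smul]
      exact continuousAt_const.congr h0.symm
  -- the a.e. identification
  have hae : ∀ᵐ t ∂(volume.restrict (Ioo 0 Tb)), ∀ᵐ x ∂(volume.restrict (ball x₀ (3 / 16))), R t x = u t x := by
    have h1 : ∀ᵐ z ∂(volume : Measure (ℝ × EuclideanSpace ℝ (Fin 3))), z ∈ Ioo 0 Tb ×ˢ ball x₀ (1 / 4) →
        uncurry U z = uncurry u z :=
      (ae_restrict_iff' (measurableSet_Ioo.prod measurableSet_ball)).1 hUae
    rw [Measure.volume_eq_prod] at h1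
    have h2 := Measure.ae_ae_of_ae_prod h1
    rw [ae_restrict_iff' measurableSet_Ioo]
    filter_upwards [h2] with t ht htI
    rw [ae_restrict_iff' measurableSet_ball]
    filter_upwards [ht] with x hx hxB
    have hxB' : x ∈ ball x₀ (1 / 4 : ℝ) := ball_subset_ball (by norm_num) hxB
    have h := hx ⟨htI, hxB'⟩
    simp only [uncurry] at h
    rw [hR, hcl_id t ⟨htI.1.le, htI.2.le⟩, hη1 x (ball_subset_closedBall hxB), one_smul, h]
  have hR0 : ∀ x ∈ ball x₀ (3 / 16 : ℝ), R 0 x = u₀ x := fun x hx => by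
    rw [hR, hcl_id 0 ⟨le_rfl, hTb.le⟩, hη1 x (ball_subset_closedBall hx), one_smul,
      hU0 x (ball_subset_closedBall (ball_subset_ball (by norm_num) hx))]
  have hC'le : C' ≤ D * C' + 2 * C' := by nlinarith
  refine ⟨R, hRc.stronglyMeasurable, fun t => ?_, fun t k hk x => ?_, fun t x y => ?_, hR0, hae⟩
  · exact contDiff_zero.2 (hRc.comp (Continuous.prodMk_right t))
  · obtain rfl : k = 0 := Nat.le_zero.1 hk
    rw [norm_iteratedFDeriv_zero]
    exact (hRb t x).trans hC'le
  · rw [iteratedFDeriv_zero_eq_comp, Function.comp_apply, Function.comp_apply, ← map_sub, LinearIsometryEquiv.norm_map]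
    exact hRH t x y

end JiaSverak2014

end Literature.Analysis.FluidPDE
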